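import Summits.KontsevichZagierPeriods.KontsevichZagierPeriods.Theorems.OctahedralSymmetryOctahedralSpanAllWeightsDefs
import Summits.KontsevichZagierPeriods.KontsevichZagierPeriods.Theorems.FurushoPentagonDoubleShuffleOfPentagon
import Mathlib.LinearAlgebra.Span.Basic
import Mathlib.Data.List.TakeWhile

/-!
# Crux `OctahedralSpanAllWeights` (stmt-KontsevichZagierPeriods-9659), line `Sketch`, block F2: front reduction and the top layers

Block F2 of the two-letter normal form (route `OctahedralSymmetry`): a UNIT word `W` (letters in
`{1, 2, 3}` = poles `i, −1, −i`) containing the pole `−1` (letter `2`) should reduce, modulo the relation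
module `rel`, to unit words of the same length with fewer letters `2` (`stub_regular_unit` of the lead's
skeleton). This file proves the weight-uniform structural part (all sorry-free):

* the lift principle `liftMap_mem_sup_unitLower` (`rel` is a shuffle ideal):
  shuffling by a TWO-LETTER word (letters `1, 3`) preserves unit-ness and the number of letters `2`;
* `unitFrontReduce`: for a fixed length, block F2 for all shorter unit words and for the unit words that
  BEGIN with the letter `2` gives block F2 for every unit word (write `W = u 2 R` with `u` the maximal
  `2`-free prefix and lift `[2 R]` by `u`; every other interleaving has a shorter `2`-free prefix);
* `unitLayerTop`: the word `2^w` (`w ≥ 1`) reduces — the seed `[2] − [1] − [3] = dilGen [2]` lifted by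
  `2^{w-1}` is `w • [2^w] − ∑ (one letter 1 or 3 inserted)`.

In the `σ`-eigenbasis of the unit letters (`a = [2]`, `d = [1] − [3]` odd, `s = [1] + [3] − [2]` even)
the seed is `−s` and the involution relation of a unit word reads `[W] ≡ (−1)^{#s} [reverse W]`; these
two INTERNAL families leave corank `5, 12, 32, 84 > 2^w` on the unit words of weight `2..5` (lead's lab,
`numerics/unitblock.py`), so the finite double shuffles — whose merged terms leave the unit alphabet —
are essential for the lower layers: that residual is the open core `stub_regular_unit_core` of the
skeleton. Sources: J. Zhao, Doc. Math. 15 (2010) §2, §5 [Zhao2010]; J. Zhao, C. R. Acad. Sci. Paris 346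
(2008) §4 [Zhao2008].
-/

noncomputable section

namespace Summit.KontsevichZagierPeriods.OctahedralSymmetry.OctaSpan.RegularUnit

open Literature.NumberTheory.Transcendental Literature.NumberTheory.Transcendental.LevelFour
open Summit.KontsevichZagierPeriods.FurushoPentagon.DoubleShuffleOfPentagon (perm_append_of_mem_shuffleWord)
/-! ## Private tools (casting shuffles, the shuffle ideal, extraction) -/

/-- Casting a term list to `WordQ` (local copy of the E2 tools). [folklore] -/
private theorem toQ_ofTerms (L : List (ℤ × List (Fin 5))) :
    toQ (ofTerms L) = (L.map fun p => (p.1 : ℚ) • sym p.2).sum := by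
  induction L with
  | nil => simp
  | cons p L ih =>
    rw [ofTerms_cons, map_add, toQ_single, ih, List.map_cons, List.sum_cons, Int.cast_smul_eq_zsmul]

/-- The shuffle cast to `WordQ` is the plain sum over the interleavings (local copy). [folklore] -/
private theorem toQ_shuffle (u v : List (Fin 5)) :
    toQ (shuffle u v) = ((MZV.shuffleWord u v).map sym).sum := by
  rw [shuffle, toQ_ofTerms, List.map_map]
  congr 1
  exact List.map_congr_left fun w _ => by simp

/-- `liftMap u [V] = u ш V` (local copy). [folklore] -/
private theorem liftMap_sym (u V : List (Fin 5)) : liftMap u (sym V) = toQ (shuffle u V) := by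
  simp [liftMap, sym]

/-- `rel` is a shuffle ideal (local copy). [cite: Zhao2010, §2 Lemma 2.2] -/
private theorem liftMap_mem_rel {u : List (Fin 5)} (hu : IsConvergent u) {x : WordQ} (hx : x ∈ rel) :
    liftMap u x ∈ rel := by
  have h : Submodule.map (liftMap u) rel ≤ rel := by
    rw [rel, Submodule.map_span_le]
    exact fun ρ hρ => mem_rel_of_isGen (IsGen.lift hu hρ)
  exact h (Submodule.mem_map_of_mem hx)

/-- Splitting a sum of basis vectors along one word (local copy). [folklore] -/
private theorem sum_map_sym_eq (L : List (List (Fin 5))) (W : List (Fin 5)) :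
    (L.map sym).sum = (L.count W : ℚ) • sym W + ((L.filter fun w => w ≠ W).map sym).sum := by
  induction L with
  | nil => simp
  | cons w L ih =>
    rw [List.map_cons, List.sum_cons, ih, List.count_cons, List.filter_cons]
    by_cases h : w = W
    · subst h
      simp only [beq_self_eq_true, ite_true, ne_eq, not_true_eq_false, decide_false, Nat.cast_add,
        Nat.cast_one, add_smul, one_smul, Bool.false_eq_true, ite_false]
      abel
    · have h1 : (w == W) = false := beq_eq_false_iff_ne.2 h
      simp only [h1, ite_false, add_zero, ne_eq, h, not_false_eq_true, decide_true, ite_true,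
        List.map_cons, List.sum_cons, Bool.false_eq_true]
      abel

/-- Extraction of one word from a sum lying in a submodule (local copy). [folklore] -/
private theorem sym_mem_of_sum_mem {T : Submodule ℚ WordQ} {L : List (List (Fin 5))} {W : List (Fin 5)}
    (hW : W ∈ L) (hsum : (L.map sym).sum ∈ T) (hrest : ∀ w ∈ L, w ≠ W → sym w ∈ T) :
    sym W ∈ T := by
  have hcount : (L.count W : ℚ) ≠ 0 := by exact_mod_cast (List.count_pos_iff.2 hW).ne'
  have hrest' : ((L.filter fun w => w ≠ W).map sym).sum ∈ T := by
    refine list_sum_mem fun x hx => ?_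
    obtain ⟨w, hw, rfl⟩ := List.mem_map.1 hx
    rw [List.mem_filter] at hw
    exact hrest w hw.1 (by simpa using hw.2)
  have h : (L.count W : ℚ) • sym W ∈ T := by
    have := T.sub_mem hsum hrest'
    rwa [sum_map_sym_eq L W, add_sub_cancel_right] at this
  have := T.smul_mem ((L.count W : ℚ)⁻¹) h
  rwa [smul_smul, inv_mul_cancel₀ hcount, one_smul] at this

/-! ## Unit words and the target span of block F2 -/

/-- A unit word is convergent (its first letter is not `0`, its last letter is not `4`). [folklore] -/
theorem isConvergent_of_isUnitWord {W : List (Fin 5)} (hU : ∀ a ∈ W, a = 1 ∨ a = 2 ∨ a = 3) :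
    IsConvergent W := by
  refine ⟨fun h => ?_, fun h => ?_⟩
  · rcases hU 0 (List.mem_of_mem_head? h) with h0 | h0 | h0 <;> exact absurd h0 (by decide)
  · rcases hU 4 (List.mem_of_mem_getLast? h) with h4 | h4 | h4 <;> exact absurd h4 (by decide)

/-- The target span of block F2 (unit words of the same length with fewer letters `2`) depends only on the
length and the number of letters `2`. [folklore] -/
theorem unitLower_congr {V W : List (Fin 5)} (h1 : V.length = W.length) (h2 : V.count 2 = W.count 2) :
    Submodule.span ℚ (sym '' {V' | V'.length = V.length ∧ (∀ a ∈ V', a = 1 ∨ a = 2 ∨ a = 3) ∧ V'.count 2 < V.count 2}) =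
      Submodule.span ℚ (sym '' {V' | V'.length = W.length ∧ (∀ a ∈ V', a = 1 ∨ a = 2 ∨ a = 3) ∧ V'.count 2 < W.count 2}) := by
  simp only [h1, h2]

/-! ## The lift principle for unit words -/

/-- **Lift principle for block F2.** If the unit word `V` reduces modulo `rel` to unit words of its length
with fewer letters `2`, then so does `u ш V` for every TWO-LETTER word `u` (letters `1, 3`), with respect to
`u ++ V`. [folklore] -/
theorem liftMap_mem_sup_unitLower {u V : List (Fin 5)} (hu : ∀ a ∈ u, a = 1 ∨ a = 3)
    (hV : sym V ∈ rel ⊔ Submodule.span ℚ (sym '' {V' | V'.length = V.length ∧ (∀ a ∈ V', a = 1 ∨ a = 2 ∨ a = 3) ∧ V'.count 2 < V.count 2})) :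
    liftMap u (sym V) ∈ rel ⊔ Submodule.span ℚ (sym '' {V' | V'.length = (u ++ V).length ∧ (∀ a ∈ V', a = 1 ∨ a = 2 ∨ a = 3) ∧ V'.count 2 < (u ++ V).count 2}) := by
  have huU : ∀ a ∈ u, a = 1 ∨ a = 2 ∨ a = 3 := fun a ha => (hu a ha).elim Or.inl fun h => Or.inr (Or.inr h)
  have hu2 : u.count 2 = 0 :=
    List.count_eq_zero.2 fun h => by rcases hu 2 h with h' | h' <;> exact absurd h' (by decide)
  rw [Submodule.mem_sup] at hV ⊢
  obtain ⟨r, hr, l, hl, hrl⟩ := hV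
  refine ⟨liftMap u r, liftMap_mem_rel (isConvergent_of_isUnitWord huU) hr, liftMap u l, ?_,
    by rw [← map_add, hrl]⟩
  refine Submodule.span_induction (p := fun x _ => liftMap u x ∈ Submodule.span ℚ (sym '' {V' | V'.length = (u ++ V).length ∧ (∀ a ∈ V', a = 1 ∨ a = 2 ∨ a = 3) ∧ V'.count 2 < (u ++ V).count 2})) ?_ (by simp)
    (fun x y _ _ hx hy => by rw [map_add]; exact Submodule.add_mem _ hx hy)
    (fun a x _ hx => by rw [map_smul]; exact Submodule.smul_mem _ a hx) hl
  rintro _ ⟨V', ⟨h1, h2, h3⟩, rfl⟩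
  rw [liftMap_sym, toQ_shuffle]
  refine list_sum_mem fun x hx => ?_
  obtain ⟨w, hw, rfl⟩ := List.mem_map.1 hx
  have hp := perm_append_of_mem_shuffleWord _ _ hw
  refine Submodule.subset_span ⟨w, ⟨?_, fun a ha => ?_, ?_⟩, rfl⟩
  · rw [hp.length_eq, List.length_append, List.length_append, h1]
  · rcases List.mem_append.1 (hp.subset ha) with hau | haV
    · exact huU a hau
    · exact h2 a haV
  · rw [hp.count_eq, List.count_append, List.count_append, hu2]; omega

/-! ### Shuffles of a word with one letter: insertions -/

/-- Inserting a letter `d` into `x :: u`: either after `x` (an insertion into `u`, with `x` prepended) or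
in front. On `WordQ`: `(x :: u) ш [d] = (x :: ·)_* (u ш [d]) + [d :: x :: u]`. [folklore] -/
theorem toQ_shuffle_cons_singleton (x d : Fin 5) (u : List (Fin 5)) :
    toQ (shuffle (x :: u) [d]) =
      Finsupp.mapDomain (List.cons x) (toQ (shuffle u [d])) + sym (d :: x :: u) := by
  rw [toQ_shuffle, toQ_shuffle, MZV.shuffleWord_cons_cons, MZV.shuffleWord_nil_right, List.map_append,
    List.sum_append]
  congr 1
  · change _ = Finsupp.mapDomain.addMonoidHom (List.cons x) ((MZV.shuffleWord u [d]).map sym).sum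
    rw [map_list_sum, List.map_map, List.map_map]
    congr 1
    refine List.map_congr_left fun w _ => ?_
    simp [sym, Finsupp.mapDomain_single]
  · simp

/-- Inserting the letter `2` into `2^b`: `b + 1` copies of `2^{b+1}`. [folklore] -/
theorem toQ_shuffle_replicate_two (b : ℕ) :
    toQ (shuffle (List.replicate b (2 : Fin 5)) [2]) = ((b + 1 : ℕ) : ℚ) • sym (List.replicate (b + 1) 2) := by
  rw [toQ_shuffle]
  have hall : ∀ w ∈ MZV.shuffleWord (List.replicate b (2 : Fin 5)) [2], w = List.replicate (b + 1) 2 :=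
    fun w hw => by
      have hp := perm_append_of_mem_shuffleWord _ _ hw
      rw [← List.replicate_succ'] at hp
      exact List.perm_replicate.1 hp
  have hmap : (MZV.shuffleWord (List.replicate b (2 : Fin 5)) [2]).map sym =
      List.replicate (MZV.shuffleWord (List.replicate b (2 : Fin 5)) [2]).length
        (sym (List.replicate (b + 1) 2)) := by
    rw [List.eq_replicate_iff]
    refine ⟨by simp, fun x hx => ?_⟩
    obtain ⟨w, hw, rfl⟩ := List.mem_map.1 hx
    rw [hall w hw]
  rw [hmap, List.sum_replicate, MZV.length_shuffleWord, ← Nat.cast_smul_eq_nsmul ℚ]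
  congr 1
  simp

/-- **Inserting the letter `2` into `2^a c 2^b`**: `(a + 1)` copies of `2^{a+1} c 2^b` and `(b + 1)` copies
of `2^a c 2^{b+1}`. [folklore] -/
theorem toQ_shuffle_X_two (c : Fin 5) (b : ℕ) : ∀ a : ℕ,
    toQ (shuffle (List.replicate a (2 : Fin 5) ++ c :: List.replicate b 2) [2]) =
      ((a + 1 : ℕ) : ℚ) • sym (List.replicate (a + 1) (2 : Fin 5) ++ c :: List.replicate b 2) +
        ((b + 1 : ℕ) : ℚ) • sym (List.replicate a (2 : Fin 5) ++ c :: List.replicate (b + 1) 2)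
  | 0 => by
    rw [List.replicate_zero, List.nil_append, List.nil_append, toQ_shuffle_cons_singleton,
      toQ_shuffle_replicate_two, Finsupp.mapDomain_smul, sym, Finsupp.mapDomain_single]
    simp only [Nat.cast_one, zero_add, one_smul, List.replicate_succ, List.replicate_zero,
      List.singleton_append]
    rw [add_comm]; rfl
  | a + 1 => by
    rw [List.replicate_succ, List.cons_append, toQ_shuffle_cons_singleton, toQ_shuffle_X_two c b a,
      Finsupp.mapDomain_add, Finsupp.mapDomain_smul, Finsupp.mapDomain_smul, sym, sym,
      Finsupp.mapDomain_single, Finsupp.mapDomain_single]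
    simp only [← List.cons_append, ← List.replicate_succ, Nat.cast_add, Nat.cast_one, sym]
    module


/-- `dilGen [2]` is the seed `[2] − [1] − [3]`. [cite: Zhao2010, §5] -/
theorem dilGen_two : dilGen [(2 : Fin 5)] = sym [2] - (sym [1] + sym [3]) := by
  simp [dilGen, dilSubst, dilLetter, toQ_single]


/-! ## Front reduction: it suffices to treat unit words beginning with the pole `−1` -/

/-- `u ++ 2 :: R` is one of the interleavings of `u` and `2 :: R`. [folklore] -/
theorem append_cons_mem_shuffleWord (u R : List (Fin 5)) :
    u ++ 2 :: R ∈ MZV.shuffleWord u (2 :: R) := by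
  induction u with
  | nil => simp
  | cons a u ih =>
    rw [MZV.shuffleWord_cons_cons, List.mem_append, List.mem_map]
    exact Or.inl ⟨_, ih, rfl⟩

/-- Every OTHER interleaving of a `2`-free word `u` with `2 :: R` has a shorter `2`-free prefix.
[folklore] -/
theorem pref2_lt_of_mem_shuffleWord : ∀ (u R : List (Fin 5)), (2 : Fin 5) ∉ u →
    ∀ w ∈ MZV.shuffleWord u (2 :: R), w ≠ u ++ 2 :: R → (w.takeWhile fun x => x ≠ 2).length < u.length
  | [], R, _, w, hw, hne => by simp at hw; exact (hne (by simpa using hw)).elim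
  | a :: u, R, hu, w, hw, hne => by
    have ha : a ≠ 2 := fun h => hu (by simp [h])
    have hu' : (2 : Fin 5) ∉ u := fun h => hu (List.mem_cons_of_mem a h)
    rw [MZV.shuffleWord_cons_cons, List.mem_append, List.mem_map, List.mem_map] at hw
    rcases hw with ⟨w', hw', rfl⟩ | ⟨w', -, rfl⟩
    · have hne' : w' ≠ u ++ 2 :: R := fun h => hne (by rw [h]; rfl)
      have := pref2_lt_of_mem_shuffleWord u R hu' w' hw' hne'
      simp only [List.length_cons] at this ⊢
      rw [List.takeWhile_cons_of_pos (by simpa using ha), List.length_cons]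
      omega
    · simp

/-- **Front reduction for block F2 (all weights).** Fix a length `n`. If block F2 holds for all shorter
unit words with a letter `2`, and for the unit words of length `n` that BEGIN with the letter `2`, then it
holds for every unit word of length `n` with a letter `2`. [folklore] -/
theorem unitFrontReduce {n : ℕ}
    (ihlt : ∀ W : List (Fin 5), W.length < n → (∀ a ∈ W, a = 1 ∨ a = 2 ∨ a = 3) → 0 < W.count 2 →
      sym W ∈ rel ⊔ Submodule.span ℚ (sym '' {V' | V'.length = W.length ∧ (∀ a ∈ V', a = 1 ∨ a = 2 ∨ a = 3) ∧ V'.count 2 < W.count 2}))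
    (ih2 : ∀ W : List (Fin 5), W.length = n → W.head? = some 2 → (∀ a ∈ W, a = 1 ∨ a = 2 ∨ a = 3) →
      sym W ∈ rel ⊔ Submodule.span ℚ (sym '' {V' | V'.length = W.length ∧ (∀ a ∈ V', a = 1 ∨ a = 2 ∨ a = 3) ∧ V'.count 2 < W.count 2}))
    (W : List (Fin 5)) (hn : W.length = n) (hU : ∀ a ∈ W, a = 1 ∨ a = 2 ∨ a = 3) (h2 : 0 < W.count 2) :
    sym W ∈ rel ⊔ Submodule.span ℚ (sym '' {V' | V'.length = W.length ∧ (∀ a ∈ V', a = 1 ∨ a = 2 ∨ a = 3) ∧ V'.count 2 < W.count 2}) := by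
  suffices key : ∀ p (W : List (Fin 5)), (W.takeWhile fun x => x ≠ 2).length = p → W.length = n →
      (∀ a ∈ W, a = 1 ∨ a = 2 ∨ a = 3) → 0 < W.count 2 →
      sym W ∈ rel ⊔ Submodule.span ℚ (sym '' {V' | V'.length = W.length ∧ (∀ a ∈ V', a = 1 ∨ a = 2 ∨ a = 3) ∧ V'.count 2 < W.count 2}) from key _ W rfl hn hU h2
  intro p
  induction p using Nat.strong_induction_on with
  | _ p ihp =>
  intro W hp hn hU h2
  set u := W.takeWhile fun x => x ≠ 2 with hu_def
  have hsplit : W = u ++ W.dropWhile fun x => x ≠ 2 := (List.takeWhile_append_dropWhile).symm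
  have hD : (W.dropWhile fun x => x ≠ 2) ≠ [] := by
    rw [Ne, List.dropWhile_eq_nil_iff]
    intro h
    have h2mem : (2 : Fin 5) ∈ W := List.count_pos_iff.1 h2
    simpa using h _ h2mem
  obtain ⟨R, hR⟩ : ∃ R, (W.dropWhile fun x => x ≠ 2) = 2 :: R := by
    refine ⟨(W.dropWhile fun x => x ≠ 2).tail, ?_⟩
    have hhead := List.head_dropWhile_not (fun x : Fin 5 => decide (x ≠ 2)) hD
    have hcons := List.cons_head_tail hD
    rw [← hcons]
    congr 1
    simpa using hhead
  rw [hR] at hsplit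
  have hu2 : (2 : Fin 5) ∉ u := fun h => by simpa using List.mem_takeWhile_imp h
  have huU : ∀ a ∈ u, a = 1 ∨ a = 2 ∨ a = 3 := fun a ha => hU a (hsplit ▸ List.mem_append_left _ ha)
  have hu13 : ∀ a ∈ u, a = 1 ∨ a = 3 := fun a ha => by
    rcases huU a ha with h | h | h
    · exact Or.inl h
    · exact absurd (h ▸ ha) hu2
    · exact Or.inr h
  have hRU : ∀ a ∈ (2 :: R), a = 1 ∨ a = 2 ∨ a = 3 := fun a ha =>
    hU a (hsplit ▸ List.mem_append_right _ ha)
  by_cases hu : u = []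
  · refine ih2 W hn ?_ hU
    rw [hsplit, hu]; rfl
  have hulen : 0 < u.length := List.length_pos_iff.2 hu
  have hRlen : (2 :: R).length < n := by
    have := congrArg List.length hsplit
    rw [List.length_append] at this; omega
  have hV := ihlt _ hRlen hRU (by simp)
  have hlift := liftMap_mem_sup_unitLower hu13 hV
  rw [liftMap_sym, ← hsplit, toQ_shuffle] at hlift
  refine sym_mem_of_sum_mem (hsplit ▸ append_cons_mem_shuffleWord u R) hlift fun w hw hne => ?_
  have hp' : (w.takeWhile fun x => x ≠ 2).length < p := by
    rw [← hp]
    exact pref2_lt_of_mem_shuffleWord u R hu2 w hw (hsplit ▸ hne)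
  have hperm := perm_append_of_mem_shuffleWord _ _ hw
  have hwlen : w.length = n := by rw [hperm.length_eq, ← hsplit, hn]
  have hw2 : w.count 2 = W.count 2 := by rw [hperm.count_eq, ← hsplit]
  have hwU : ∀ a ∈ w, a = 1 ∨ a = 2 ∨ a = 3 := fun a ha => hU a (hsplit ▸ hperm.subset ha)
  have := ihp _ hp' w rfl hwlen hwU (hw2 ▸ h2)
  rwa [unitLower_congr (hwlen.trans hn.symm) hw2] at this

/-! ## The top layer: the word `2^w` -/

/-- **The top layer of block F2 (all weights `w ≥ 1`)**: `[2^w] ∈ rel ⊔ unitLower (2^w)`. The seed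
`dilGen [2] = [2] − [1] − [3]` lifted by `2^{w−1}` equals `w • [2^w] − ∑ (2^{w-1} ш [1]) − ∑ (2^{w-1} ш [3])`,
and every word of the two shuffles is a unit word with `w − 1` letters `2`. [cite: Zhao2010, §5] -/
theorem unitLayerTop (m : ℕ) : sym (List.replicate (m + 1) (2 : Fin 5)) ∈
    rel ⊔ Submodule.span ℚ (sym '' {V' | V'.length = (List.replicate (m + 1) (2 : Fin 5)).length ∧ (∀ a ∈ V', a = 1 ∨ a = 2 ∨ a = 3) ∧ V'.count 2 < (List.replicate (m + 1) (2 : Fin 5)).count 2}) := by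
  set u : List (Fin 5) := List.replicate m 2 with hu
  set W : List (Fin 5) := List.replicate (m + 1) 2 with hW
  have huconv : IsConvergent u :=
    isConvergent_of_isUnitWord fun a ha => Or.inr (Or.inl (List.eq_of_mem_replicate ha))
  -- the lifted seed lies in `rel`
  have hseed : liftMap u (dilGen [2]) ∈ rel :=
    liftMap_mem_rel huconv (mem_rel_of_isGen (IsGen.dil (by decide) (by decide)))
  have hdil : dilGen [(2 : Fin 5)] = sym [2] - (sym [1] + sym [3]) := by
    simp [dilGen, dilSubst, dilLetter, toQ_single]
  rw [hdil, map_sub, map_add, liftMap_sym, liftMap_sym, liftMap_sym] at hseed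
  -- the two side shuffles lie in `unitLower W`
  have hside : ∀ c : Fin 5, (c = 1 ∨ c = 3) → toQ (shuffle u [c]) ∈
      Submodule.span ℚ (sym '' {V' | V'.length = W.length ∧ (∀ a ∈ V', a = 1 ∨ a = 2 ∨ a = 3) ∧ V'.count 2 < W.count 2}) := by
    intro c hc
    have hc2 : c ≠ 2 := by rcases hc with rfl | rfl <;> decide
    rw [toQ_shuffle]
    refine list_sum_mem fun x hx => ?_
    obtain ⟨w, hw, rfl⟩ := List.mem_map.1 hx
    have hp := perm_append_of_mem_shuffleWord _ _ hw
    refine Submodule.subset_span ⟨w, ⟨?_, fun a ha => ?_, ?_⟩, rfl⟩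
    · rw [hp.length_eq]; simp [hu, hW]
    · rcases List.mem_append.1 (hp.subset ha) with hau | hac
      · exact Or.inr (Or.inl (List.eq_of_mem_replicate hau))
      · rw [List.mem_singleton.1 hac]
        exact hc.elim Or.inl fun h => Or.inr (Or.inr h)
    · rw [hp.count_eq, List.count_append]
      simp [hu, hW, hc2]
  -- `u ш [2] = (m+1) • [2^{m+1}]`
  have hmain : toQ (shuffle u [2]) = ((m + 1 : ℕ) : ℚ) • sym W := by
    rw [toQ_shuffle]
    have huW : u ++ [2] = W := by simp [hu, hW, List.replicate_succ']
    have hall : ∀ w ∈ MZV.shuffleWord u [2], w = W := fun w hw => by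
      have hp := perm_append_of_mem_shuffleWord _ _ hw
      rw [huW, hW] at hp
      exact List.perm_replicate.1 hp
    have hmap : (MZV.shuffleWord u [2]).map sym =
        List.replicate (MZV.shuffleWord u [2]).length (sym W) := by
      rw [List.eq_replicate_iff]
      refine ⟨by simp, fun x hx => ?_⟩
      obtain ⟨w, hw, rfl⟩ := List.mem_map.1 hx
      rw [hall w hw]
    rw [hmap, List.sum_replicate, MZV.length_shuffleWord, ← Nat.cast_smul_eq_nsmul ℚ]
    congr 1
    simp [hu]
  rw [hmain] at hseed
  -- divide by `m + 1`
  have hmem : ((m + 1 : ℕ) : ℚ) • sym W ∈ rel ⊔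
      Submodule.span ℚ (sym '' {V' | V'.length = W.length ∧ (∀ a ∈ V', a = 1 ∨ a = 2 ∨ a = 3) ∧ V'.count 2 < W.count 2}) := by
    have h13 : toQ (shuffle u [1]) + toQ (shuffle u [3]) ∈
        Submodule.span ℚ (sym '' {V' | V'.length = W.length ∧ (∀ a ∈ V', a = 1 ∨ a = 2 ∨ a = 3) ∧ V'.count 2 < W.count 2}) :=
      Submodule.add_mem _ (hside 1 (Or.inl rfl)) (hside 3 (Or.inr rfl))
    have := Submodule.add_mem _ (Submodule.mem_sup_left hseed) (Submodule.mem_sup_right h13)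
    rwa [sub_add_cancel] at this
  have hne : ((m + 1 : ℕ) : ℚ) ≠ 0 := by exact_mod_cast Nat.succ_ne_zero m
  have := Submodule.smul_mem _ (((m + 1 : ℕ) : ℚ)⁻¹) hmem
  rwa [smul_smul, inv_mul_cancel₀ hne, one_smul] at this

end Summit.KontsevichZagierPeriods.OctahedralSymmetry.OctaSpan.RegularUnit

end
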